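import Summits.CriticalPhenomena.SAWScalingLimit.Theorems.SAWCompassLatticeSurfaceUniversalityApproxDefs
import Mathlib.Analysis.Convex.Hull

/-!
# Objects of the line `registered`, III (reshape v7 by the lead c2) for the crux
# `SAWCompassLattice.SurfaceUniversality` (stmt-CriticalPhenomena-6964): TIGHT probe rules and the
# repaired statement `LipSiteFaceApproxIndependence`

Route `SAWCompassLattice` (sub-problem `SAWScalingLimit`). Skeleton v6 rested the `ℤ²` side of the crux on
`LipApproxIndependence` (`…SurfaceUniversalityApproxDefs.lean`): ANY two probe rules and ANY two pinned
endpoint approximations of a Dobrushin domain give critical plus path laws merging on bounded Lipschitz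
test functions. The lead's adversarial worker W4 found that statement FALSE as typed (paper witness,
`Cruxes/SurfaceUniversality/Lines/birth-lipApproxIndependence-refutation.md`): a probe rule may give the
two PORT kinds different admission depths (e.g. centre probe `({0}, closed)`, vertical-port probe
`({-3/2}, closed)`, horizontal-port probe `({-2i}, closed)`); along a flat axis-parallel side of a polygonal
domain this keeps the two boundary rows of centres with their horizontal links but drops their vertical
links, so a boundary row becomes an ISOLATED CORRIDOR sealed at a convex corner, and a column along a wall
becomes a corridor attached to the bulk only at a REFLEX corner; two admissible pinned endpoint families
for this ONE rule on ONE octagon (`HalfAnnulusQuad`) then give, at every mesh `δ = 1/(2n)`, a Dirac law on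
the straight bottom side versus laws forced up the wall — bounded-Lipschitz distance `≥ 1/4`, `δ`-uniformly,
with no SAW asymptotics. The slack exploited is that a port was kept or dropped by ITS OWN probe, unrelated
to the probes of the two centres it joins.

The diagnosis (this file): a **tight** probe rule must carry,
for every pair of centre probes `(K₁, cl₁)`, `(K₂, cl₂)`, a port probe contained in the CONVEX HULL of
the two centre probes translated to the two centres the port joins (west/east for a vertical port,
south/north for a horizontal one), with a closed flag unless both centre flags are open. Consequence
(the point of the definition; not proved here): wherever the target is locally convex — along flat
sides, at convex corners, in the bulk — "both adjacent centres kept ⟹ the port between them kept", so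
the kept set along a flat side is a FULL grid above a depth threshold (each centre probe passes iff the
depth exceeds `-δ · inf im K`; a list passes above the minimum threshold), and ports can be dropped
between kept centres only within `O(δ)` of reflex features of `∂Ω`. Both rules of the line are tight
with ZERO slack: `siteRule` (centre probe = the site point; port probe = the closed `ℤ²`-edge = the hull
of the two site points) and `faceRule` (centre probe = the closed square; port probes = the squares of
the two adjacent faces, each inside the hull). W4's rule is not (`-3/2 ∉ [-1/2, 1/2]`).

Contents (definitions and `rfl`-level facts only):
* `TightProbeRule` (extends `ProbeRule` by `hull_vport`, `hull_hport`), `siteTightRule`,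
  `faceTightRule` (`.toProbeRule = siteRule`, resp. `faceRule`, by `rfl`);
* `lineRule : Bool → ProbeRule` (`false ↦ siteRule`, `true ↦ faceRule`) and `LipSiteFaceApproxIndependence`
  — THE REPAIRED `ℤ²`-SIDE STATEMENT (`@[conjecture]`, obligation node of skeleton v7): `LipApproxIndependence`
  RESTRICTED TO THE TWO HONEST (tight, zero-slack) RULES OF THE LINE, everything else verbatim (pinned
  endpoints spelled out, bounded-Lipschitz merging along `𝓝[>] 0`). A second adversarial pass (worker W5,
  `Cruxes/SurfaceUniversality/Lines/birth-lipTightApproxIndependence-analysis.md`) found no `δ`-uniform witness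
  against the tight-rule form on polygons / piecewise-`C¹` domains (exact enumeration of ~900 tight rules: every
  defect within `2.5δ/sin(φ/2)` of a reflex vertex, forced prefixes `≤ 3.5δ`) and recommended this restriction
  as costless hardening against designer rules on wild Jordan domains (the glue only ever uses the two rules);
* `lipSiteFaceApproxIndependence_of_lipApproxIndependence` (the repaired statement is a special case of the
  refuted one — recorded only to orient readers; the refuted one is never used).

Sources: as `…ApproxDefs` (Lawler–Schramm–Werner 2004 §3.4.2; Kennedy–Lawler arXiv:1109.3091); the
refutation and the repair are the line's own (lead c2, worker W4). NOT here: the stubs, the glue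
(skeleton v7 / `…GlueV7.lean`), any general tight-rule statement (deliberately not filed: reuse on other lattices needs other vocabularies, and
generality is refutation surface).
-/

noncomputable section

namespace Summit.CriticalPhenomena.SAWScalingLimit.Theorems.SurfaceUniversality

open MeasureTheory Filter Topology Set Metric
open scoped NNReal ENNReal BoundedContinuousFunction
open Literature.Probability.RandomPlanarGeometry
open Literature.Probability.RandomPlanarGeometry.SAW
open Literature.Probability.RandomPlanarGeometry.SAW.YangBaxter
open Literature.Probability.LatticeModels (Site)
open Complex (I)

/-! ### Tight probe rules -/

/-- **A tight probe rule**: a probe rule in which the PORT probes are slaved to the CENTRE probes —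
for every pair of centre probes `(K₁, cl₁)`, `(K₂, cl₂)` there is a vertical-port probe inside the
convex hull of `K₁ - 1/2` (the west centre of a vertical port sits `1/2` to its west) and `K₂ + 1/2`
(east centre), and a horizontal-port probe inside the convex hull of `K₁ - i/2` (south centre) and
`K₂ + i/2` (north centre), whose flag is `closed` unless both centre flags are `open`. So where the
target is locally convex, two kept adjacent centres are always joined by a kept port (no boundary
corridors: the refutation of `LipApproxIndependence` used a rule violating exactly this). [folklore] -/
structure TightProbeRule extends ProbeRule where
  /-- every pair of centre probes dominates some vertical-port probe (west centre at `-1/2`, east at `+1/2`) -/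
  hull_vport : ∀ p₁ ∈ centre, ∀ p₂ ∈ centre, ∃ q ∈ vport,
    q.1 ⊆ convexHull ℝ ((fun z : ℂ => z - 1 / 2) '' p₁.1 ∪ (fun z : ℂ => z + 1 / 2) '' p₂.1) ∧
      (q.2 = true ∨ (p₁.2 = false ∧ p₂.2 = false))
  /-- every pair of centre probes dominates some horizontal-port probe (south centre at `-i/2`, north at `+i/2`) -/
  hull_hport : ∀ p₁ ∈ centre, ∀ p₂ ∈ centre, ∃ q ∈ hport,
    q.1 ⊆ convexHull ℝ ((fun z : ℂ => z - I / 2) '' p₁.1 ∪ (fun z : ℂ => z + I / 2) '' p₂.1) ∧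
      (q.2 = true ∨ (p₁.2 = false ∧ p₂.2 = false))

/-- Membership in a singleton probe list. [folklore] -/
theorem mem_probe_singleton_iff {p q : Set ℂ × Bool} : p ∈ [q] ↔ p = q := List.mem_singleton

/-- The segment between two points is the convex hull of the two translated singletons. [folklore] -/
theorem segment_subset_convexHull_image_singleton (c a b : ℂ) :
    segment ℝ (c + a) (c + b) ⊆
      convexHull ℝ ((fun z : ℂ => z + a) '' {c} ∪ (fun z : ℂ => z + b) '' {c}) := by
  rw [image_singleton, image_singleton, union_singleton, convexHull_pair, segment_symm]

/-- **The site rule is tight** (with zero slack: its port probe IS the hull of the two site points):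
vertical port `segment (-1) 0 = hull {-1/2 - 1/2, -1/2 + 1/2}`, horizontal port
`segment (-1/2 - i/2) (-1/2 + i/2) = hull {-1/2 - i/2, -1/2 + i/2}`, flags closed. [folklore] -/
def siteTightRule : TightProbeRule where
  toProbeRule := siteRule
  hull_vport := by
    intro p₁ hp₁ p₂ hp₂
    have h₁ : p₁ = ({-(1 / 2 : ℂ)}, false) := mem_probe_singleton_iff.1 hp₁
    have h₂ : p₂ = ({-(1 / 2 : ℂ)}, false) := mem_probe_singleton_iff.1 hp₂
    subst h₁ h₂
    refine ⟨(segment ℝ (-1 : ℂ) 0, true), List.mem_singleton.2 rfl, ?_, Or.inl rfl⟩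
    have h := segment_subset_convexHull_image_singleton (-(1 / 2 : ℂ)) (-(1 / 2 : ℂ)) (1 / 2 : ℂ)
    have e1 : (-(1 / 2 : ℂ)) + -(1 / 2 : ℂ) = -1 := by ring
    have e2 : (-(1 / 2 : ℂ)) + (1 / 2 : ℂ) = 0 := by ring
    rw [e1, e2] at h
    simpa only [sub_eq_add_neg] using h
  hull_hport := by
    intro p₁ hp₁ p₂ hp₂
    have h₁ : p₁ = ({-(1 / 2 : ℂ)}, false) := mem_probe_singleton_iff.1 hp₁
    have h₂ : p₂ = ({-(1 / 2 : ℂ)}, false) := mem_probe_singleton_iff.1 hp₂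
    subst h₁ h₂
    refine ⟨(segment ℝ (((-(1 / 2) : ℝ) : ℂ) + ((-(1 / 2) : ℝ) : ℂ) * I)
      (((-(1 / 2) : ℝ) : ℂ) + (((1 / 2) : ℝ) : ℂ) * I), true), List.mem_singleton.2 rfl, ?_, Or.inl rfl⟩
    have h := segment_subset_convexHull_image_singleton (-(1 / 2 : ℂ)) (-(I / 2)) (I / 2)
    have e1 : (-(1 / 2 : ℂ)) + -(I / 2) = ((-(1 / 2) : ℝ) : ℂ) + ((-(1 / 2) : ℝ) : ℂ) * I := by
      push_cast; ring
    have e2 : (-(1 / 2 : ℂ)) + I / 2 = ((-(1 / 2) : ℝ) : ℂ) + (((1 / 2) : ℝ) : ℂ) * I := by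
      push_cast; ring
    rw [e1, e2] at h
    simpa only [sub_eq_add_neg] using h

/-- `siteTightRule` is `siteRule` with its tightness certificate. [folklore] -/
@[simp] theorem siteTightRule_toProbeRule : siteTightRule.toProbeRule = siteRule := rfl

/-- **The face rule is tight**: for the (only) pair of centre probes (the square, the square), the first
vertical-port probe (the west face's square `= square - 1/2`) lies in the hull of `square - 1/2` and
`square + 1/2`, and likewise horizontally; all flags open. [folklore] -/
def faceTightRule : TightProbeRule where
  toProbeRule := faceRule
  hull_vport := by
    intro p₁ hp₁ p₂ hp₂
    have h₁ : p₁ = (centredSquare, false) := mem_probe_singleton_iff.1 hp₁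
    have h₂ : p₂ = (centredSquare, false) := mem_probe_singleton_iff.1 hp₂
    subst h₁ h₂
    refine ⟨((fun z : ℂ => z + (-(1 / 2 : ℂ))) '' centredSquare, false), ?_, ?_, Or.inr ⟨rfl, rfl⟩⟩
    · show _ ∈ faceRule.vport
      simp [faceRule]
    · intro z hz
      refine subset_convexHull ℝ _ (Or.inl ?_)
      obtain ⟨w, hw, rfl⟩ := hz
      exact ⟨w, hw, by ring⟩
  hull_hport := by
    intro p₁ hp₁ p₂ hp₂
    have h₁ : p₁ = (centredSquare, false) := mem_probe_singleton_iff.1 hp₁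
    have h₂ : p₂ = (centredSquare, false) := mem_probe_singleton_iff.1 hp₂
    subst h₁ h₂
    refine ⟨((fun z : ℂ => z + (-(I / 2))) '' centredSquare, false), ?_, ?_, Or.inr ⟨rfl, rfl⟩⟩
    · show _ ∈ faceRule.hport
      simp [faceRule]
    · intro z hz
      refine subset_convexHull ℝ _ (Or.inl ?_)
      obtain ⟨w, hw, rfl⟩ := hz
      exact ⟨w, hw, by ring⟩

/-- `faceTightRule` is `faceRule` with its tightness certificate. [folklore] -/
@[simp] theorem faceTightRule_toProbeRule : faceTightRule.toProbeRule = faceRule := rfl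

/-! ### The repaired statement: the two honest rules only -/

/-- The two rules of the line, indexed by a Boolean: `false ↦ siteRule` (canonical site discretisation
`meshVertices`/`meshGraph`, drawn shifted by `δ/2`), `true ↦ faceRule` (`meshFaces (π/2)` and the ports on
their sides). Both are tight with zero slack (`siteTightRule`, `faceTightRule`). [folklore] -/
def lineRule : Bool → ProbeRule
  | false => siteRule
  | true => faceRule

/-- `lineRule false = siteRule`. [folklore] -/
@[simp] theorem lineRule_false : lineRule false = siteRule := rfl

/-- `lineRule true = faceRule`. [folklore] -/
@[simp] theorem lineRule_true : lineRule true = faceRule := rfl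

/-- STUB STATEMENT `LipSiteFaceApproxIndependence` (**independence of the lattice approximation, at
bounded-Lipschitz level; one model; the two honest discretisations** — the repair of the refuted
`LipApproxIndependence`): for every Dobrushin domain `D`, any two of the line's rules `lineRule i`,
`lineRule i'` (site or face) and any two pinned endpoint approximations `(u, v)`, `(u', v')` (for all small
`δ > 0` joined by a self-avoiding plus path through the selected vertex set, rescaled drawings converging to
`D.pt 0`, `D.pt 1`; spelled out as three hypotheses each), the critical plus-lattice (= subdivided `ℤ²`)
self-avoiding path laws through `probeSupport (lineRule i) D.carrier δ` from `u δ` to `v δ` and through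
`probeSupport (lineRule i') D.carrier δ` from `u' δ` to `v' δ` merge on bounded LIPSCHITZ test functions of
`CurveClass ℂ` as `δ → 0⁺`. Instances: `i = i' = false` is endpoint robustness of `SAW.law` (item
stmt-CriticalPhenomena-0776 at Lipschitz level, through the landed site dictionary); `i = i' = true` the same for
the plus law between ports; `(false, true)` gives the line's `LipPlusPointIsZ2` through the landed plumbing. Both
rules are tight (no boundary corridors — the mechanism that refutes the all-rules statement), with zero slack.
OPEN named conjecture of this line (obligation node, registered stub `stub_lipSiteFaceApproxIndependence` of
crux stmt-CriticalPhenomena-6964; NOT a literature fact).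
[cite: LawlerSchrammWerner2004SAW, §3.4.2 (the boundary-to-boundary measure for lattice approximations of the domain and endpoints; conjectural)]
[cite: KennedyLawler2013, §1–2 (lattice effects in the scaling limit enter through boundary densities at free endpoints)] -/
@[conjecture] def LipSiteFaceApproxIndependence : Prop :=
  ∀ (D : DobrushinDomain) (i i' : Bool) (u v u' v' : ℝ → PVert),
    (∀ᶠ δ in 𝓝[>] (0 : ℝ), (u δ, v δ) ∈ plusJoinable (probeSupport (lineRule i) D.carrier δ)) →
    Tendsto (fun δ : ℝ => (δ : ℂ) * PortGadget.embed plusPos (u δ)) (𝓝[>] (0 : ℝ)) (𝓝 (D.pt 0)) →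
    Tendsto (fun δ : ℝ => (δ : ℂ) * PortGadget.embed plusPos (v δ)) (𝓝[>] (0 : ℝ)) (𝓝 (D.pt 1)) →
    (∀ᶠ δ in 𝓝[>] (0 : ℝ), (u' δ, v' δ) ∈ plusJoinable (probeSupport (lineRule i') D.carrier δ)) →
    Tendsto (fun δ : ℝ => (δ : ℂ) * PortGadget.embed plusPos (u' δ)) (𝓝[>] (0 : ℝ)) (𝓝 (D.pt 0)) →
    Tendsto (fun δ : ℝ => (δ : ℂ) * PortGadget.embed plusPos (v' δ)) (𝓝[>] (0 : ℝ)) (𝓝 (D.pt 1)) →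
    ∀ (f : BoundedContinuousFunction (CurveClass ℂ) ℝ) (L : ℝ≥0), LipschitzWith L f →
      Tendsto (fun δ : ℝ =>
          (∫ x, f x ∂(plusPathLaw (probeSupport (lineRule i) D.carrier δ) δ (u δ) (v δ))) -
            ∫ x, f x ∂(plusPathLaw (probeSupport (lineRule i') D.carrier δ) δ (u' δ) (v' δ)))
        (𝓝[>] (0 : ℝ)) (𝓝 0)

/-- The repaired statement is a SPECIAL CASE of the refuted one (the two rules are rules): recorded only to
orient the reader (`LipApproxIndependence` is false and is never used). [folklore] -/
theorem lipSiteFaceApproxIndependence_of_lipApproxIndependence : LipApproxIndependence → LipSiteFaceApproxIndependence :=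
  fun h D i i' u v u' v' => h D (lineRule i) (lineRule i') u v u' v'

end Summit.CriticalPhenomena.SAWScalingLimit.Theorems.SurfaceUniversality

end
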